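import Mathlib.NumberTheory.ArithmeticFunction.Misc
import Literature.NumberTheory.LFunctions.ExceptionalCharacterFirstMomentProgressions
import Literature.NumberTheory.LFunctions.LogIntegral
import Literature.NumberTheory.LFunctions.LogIntegralAsymptoticsProofs
import Literature.NumberTheory.LFunctions.LogIntegralStrictMonoProofs
import Literature.NumberTheory.LFunctions.LogIntegralTwoPosProofs
import Literature.NumberTheory.LFunctions.RHWave0
import HarnessLib
import Summits.Parity.GeneralizedHardyLittlewood.Theorems.UnboundedSiegelZeros

/-!
# The Titchmarsh divisor problem under an exceptional character: a Siegel zero lowers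
# `∑ Λ(n) τ(n − 1)` by an explicit secondary term (Drappeau 2017, Theorems 1.1–1.2, Corollaries 1.3–1.4)

Statement layer for the cell `parity-realchar` (SIEGEL INSTRUMENT, deliverable (3): the «illusory
world» typed — conditional consequences of exceptional zeros), NEW-TOPIC CANDIDATE «Titchmarsh
divisor problem under an exceptional character» (theory's topic-vs-source call pending). Source:
S. Drappeau, *Sums of Kloosterman sums in arithmetic progressions, and the error term in the
dispersion method*, Proc. London Math. Soc. (3) 114 (2017), no. 4, 684–732 [Drappeau2017]; held
copy = arXiv:1504.05549 (tex), §1.1 (Theorem 1 of Fouvry/BFI, Theorems 1.1, 1.2, Corollaries 1.3,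
1.4 with the definitions of `T(x)`, `C₁`, `C₂`, `C₁(q)`, `C₂(q)`) and §6 (Lemma 6.1 = Page's theorem,
the definition of the `x`-exceptional character, §6.3 "we merely have to add to our estimate for
`T(x)` the additional contribution of the `x`-exceptional character (if it exists)").

## What the source prints (§1.1, §6)

`T(x) := ∑_{1 < n ≤ x} Λ(n) τ(n − 1)`; `C₁ := ∏_p (1 + 1/(p(p−1)))`, `C₂ := ∑_p log p/(1 + p(p−1))`;
for `q ≥ 1`, `C₁(q) := (1/φ(q)) ∏_{p ∤ q} (1 + 1/(p(p−1)))`, `C₂(q) := ∑_{p ∤ q} log p/(1 + p(p−1))`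
("Note that `C₁ = C₁(1)` and `C₂ = C₂(1)`").
**Theorem 1.1.** "Assume GRH. Then for some `δ > 0` and all `x ≥ 2`,
`T(x) = C₁x{log x + 2γ − 1 − 2C₂} + O(x^{1−δ})`."
**Theorem 1.2.** "There exist `b > 0` and `δ > 0` such that
`T(x) = C₁x{log x + 2γ − 1 − 2C₂} − C₁(q)(x^β/β){log(x/q²) + 2γ − 1/β − 2C₂(q)} + O(x e^{−δ√log x})`.
The second term is only to be taken into account if there is a primitive character `χ (mod q)` with
`q ≤ e^{√log x}` whose Dirichlet `L`-function has a real zero `β` with `β ≥ 1 − b/√log x`."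
**Corollary 1.3.** "In the same notation as Theorem 1.2,
`∑_{p ≤ x} τ(p − 1) = C₁{x + 2 li(x)(γ − C₂)} − C₁(q){x^β/β + 2 li(x^β)(γ − log q − C₂(q))}
+ O(x e^{−δ√log x})`."
**Corollary 1.4.** "With an effective implicit constant, we have
`∑_{p ≤ x} τ(p − 1) ≤ C₁{x + 2 li(x)(γ − C₂)} + O(x e^{−δ√log x})`."
(Between 1.3 and 1.4: "Since `χ`, if it exists, is a real character, then `χ(a) = 1` whenever `a` is a
perfect square (for instance `a = 1`), in which case we have an unconditional inequality." Abstract: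
"we isolate the possible contribution of Siegel zeroes, showing it is always negative.")
§6, Lemma 6.1 (Page, [IK]): "There is an absolute constant `b` such that for all `Q, T ≥ 2` …
`s ↦ ∏_{q ≤ Q} ∏_{χ mod q} L(s, χ)` has at most one zero `s = β` satisfying `Re(s) > 1 − b/log(QT)` and
`|Im(s)| ≤ T`. If it exists, the zero `β` is real and it is the zero of a unique function `L(s, χ̃)` for
some primitive real character `χ̃`. Given a large `x`, we shall say that `χ̃` is `x`-exceptional if the
above conditions are met with `Q = T = e^{√log x}`."

## Typing notes

* `γ` is Mathlib's `Real.eulerMascheroniConstant`; `τ = σ₀` (`ArithmeticFunction.sigma 0`); the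
  infinite product / sums over primes are `tprod`/`tsum` over `Nat.Primes` (the paper's series are
  absolutely convergent; `C2_summable` below PROVES it for `C₂(q)`); `li` is the tree's
  `Literature.NumberTheory.LFunctions.logIntegral`; "GRH" (the Riemann Hypothesis for all Dirichlet
  `L`-functions) is the tree's `GeneralizedRiemannHypothesis`.
* **The `x`-exceptional character.** The proof-level form (§6, Lemma 6.1 with `Q = T = e^{√log x}`) is
  LITERALLY the `x`-exceptional character of Drappeau–Fiorilli 2021 (same author; same Lemma), typed
  in the tree as `DrappeauFiorilli2021.IsExceptionalAt b x q̃ χ̃ β` (`q̃ ≤ e^{√log x}`, `χ̃` primitive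
  real, `β` a real zero with `β > 1 − b/log(QT) = 1 − b/(2√log x)`): that predicate is REUSED here. The
  introduction's paraphrase "`β ≥ 1 − b/√log x`" differs from §6 by `b ↦ 2b` and `≥` vs `>`; both are
  immaterial under the printed `∃ b > 0` (a boundary zero `β = 1 − b/√log x` contributes
  `≪ x e^{−b√log x} log x`, absorbed by shrinking `δ`), and for `b` below the classical zero-free
  constant a primitive character with such a real zero is real, as Lemma 6.1 says — so "the second
  term, if the exceptional character exists" is rendered, exactly as for Drappeau–Fiorilli, by
  quantifying over ALL `(q̃, χ̃, β)` with `IsExceptionalAt b x q̃ χ̃ β` (at most one, PROVED in the tree: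
  `DrappeauFiorilli2021.exists_atMostOne_exceptional`).
* The `O`-constants are rendered as one `K` valid for all `x ≥ 2`; "effective" (Cor 1.4) is recorded
  in prose only (no kernel content).
* **S6 vacuity audit.** As for I.11: an `x`-exceptional zero has quality `> 2/b` relative to its own
  conductor on a bounded `x`-window; a bounded-quality hypothesis is not voided by the (ineffective)
  Siegel theorem. Not S6. The facts are unconditional asymptotic formulae; the «illusory» content is
  the secondary term, present iff the exceptional character is.

## Contents

* definitions `Drappeau2017.T`, `primeDivisorSum` (`∑_{p ≤ x} τ(p−1)`), `eulerFactor`, `C1`, `logTerm`,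
  `C2`, `mainTerm`, `siegelTerm`, `mainTermPrimes`, `siegelTermPrimes`;
* NAMED FACTS AS PRINTED: `drappeau2017_theorem11` (GRH form), `drappeau2017_theorem12`,
  `drappeau2017_corollary13`, `drappeau2017_corollary14`;
* PROVED: `Drappeau2017.C2_summable`, `C2_nonneg`, `C2_le` (`0 ≤ C₂(q) ≤ C₂ < ∞`; private termwise
  bound `log p/(1 + p(p−1)) ≤ 4p^{−3/2}`), `one_le_eulerFactor`, `one_le_eulerProduct`, `C1_pos`; `siegelTerm_pos` (for every `b > 0` there is `x₀(b)` beyond which the Siegel term of any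
  `x`-exceptional triple is POSITIVE — the abstract's "always negative" contribution `−C₁(q)(x^β/β){…}`);
  readings of Theorem 1.2: `T_asymp_of_not_exceptional` (no exceptional character ⇒ Fouvry–BFI main
  term with error `x e^{−δ√log x}`), `T_asymp_of_isSiegelZero` (a Tao–Teräväinen Siegel zero of
  quality `η` with `bη > 2` switches the secondary term on for `log² q̃ ≤ log x < (bη log q̃/2)²`),
  `T_lowered_frequently_of_unboundedSiegelZeros` (`UnboundedSiegelZeros` ⇒ at arbitrarily large `x`
  the Titchmarsh divisor sum sits BELOW the Fouvry–BFI main term by a positive explicit Siegel term,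
  up to `O(x e^{−δ√log x})`); appended 2026-08-27: `T_mono`, `mainTerm_ge`,
  `T_le_mainTerm_of_theorem12` — the ONE-SIDED inequality `T(x) ≤ C₁x{…} + Kxe^{−δ√log x}` for all
  `x ≥ 2`, PROVED from Theorem 1.2 (the `Λ`-weighted analogue of Corollary 1.4); appended (ii):
  `siegelTermPrimes_pos` (the secondary term over primes is positive for large `x`, via the tree's
  `li x ∼ x/log x`), `primeDivisorSum_mono`, **`corollary14_of_corollary13`** — Corollary 1.4 DERIVED in
  the kernel from Corollary 1.3.

Index only (not typed): Theorem 1 (Fouvry 1985 / BFI 1986, the unconditional `O_A(x/(log x)^A)`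
form), Theorems 1.5–1.6 (correlations of divisor functions), Theorems 6.2/Proposition 6.3 (primes in
progressions with the exceptional term — cf. the tree's `DrappeauFiorilli2021` objects), §§2–5
(Kuznetsov/Deshouillers–Iwaniec machinery).

LABEL: instrument / statement layer («illusory world»). WHAT THIS IS NOT: no claim that an
exceptional character exists; nothing here bears on parity; Corollary 1.4 is the paper's
unconditional content and is typed as a fact, not proved.

## References

* [Drappeau2017] S. Drappeau, Proc. London Math. Soc. (3) 114 (2017) 684–732,
  doi:10.1112/plms.12022 = arXiv:1504.05549: §1.1 Theorems 1.1, 1.2, Corollaries 1.3, 1.4; §6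
  Lemma 6.1 and the definition after it; §6.3.
* [DrappeauFiorilli2021] S. Drappeau, D. Fiorilli, Trans. London Math. Soc. 8 (2021) 174–185,
  Theorem 1.2 and the definition after it (the `x`-exceptional character; tree
  `DrappeauFiorilli2021.IsExceptionalAt`).
* [TaoTeravainen2021] T. Tao, J. Teräväinen, J. London Math. Soc. 106 (2022), Definition 1.4
  (`IsSiegelZero`, `UnboundedSiegelZeros`).
-/

noncomputable section

open Finset Real Filter
open scoped ArithmeticFunction.vonMangoldt ArithmeticFunction.sigma
open Literature.Barriers.Parity

namespace Literature.NumberTheory.LFunctions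

namespace Drappeau2017

open DrappeauFiorilli2021

/-! ### The printed objects -/

/-- `T(x) := ∑_{1 < n ≤ x} Λ(n) τ(n − 1)` (`τ = σ₀`, the number of divisors).
[cite: Drappeau2017, §1.1 (definition of T(x))] -/
def T (x : ℝ) : ℝ :=
  ∑ n ∈ Finset.Ioc 1 ⌊x⌋₊, Λ n * (σ 0 (n - 1) : ℝ)

/-- `∑_{p ≤ x} τ(p − 1)`, the Titchmarsh divisor sum over primes (Corollaries 1.3–1.4).
[cite: Drappeau2017, §1.1 (1.2) and Corollary 1.3] -/
def primeDivisorSum (x : ℝ) : ℝ :=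
  ∑ p ∈ (Finset.Iic ⌊x⌋₊).filter Nat.Prime, (σ 0 (p - 1) : ℝ)

/-- The Euler factor `1 + 1/(p(p−1))` at a prime `p`, replaced by `1` when `p ∣ q` (so that the
product over all primes is the printed product over `p ∤ q`). [cite: Drappeau2017, §1.1 (definitions of C₁, C₁(q))] -/
def eulerFactor (q : ℕ) (p : Nat.Primes) : ℝ :=
  if (p : ℕ) ∣ q then 1 else 1 + 1 / (((p : ℕ) : ℝ) * ((((p : ℕ) : ℝ)) - 1))

/-- `C₁(q) := (1/φ(q)) ∏_{p ∤ q} (1 + 1/(p(p−1)))`; `C₁ = C₁(1)`. [cite: Drappeau2017, §1.1 (definitions of C₁, C₁(q))] -/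
def C1 (q : ℕ) : ℝ :=
  (1 / (Nat.totient q : ℝ)) * ∏' p : Nat.Primes, eulerFactor q p

/-- The term `log p/(1 + p(p−1))` at a prime `p`, replaced by `0` when `p ∣ q`.
[cite: Drappeau2017, §1.1 (definitions of C₂, C₂(q))] -/
def logTerm (q : ℕ) (p : Nat.Primes) : ℝ :=
  if (p : ℕ) ∣ q then 0 else Real.log ((p : ℕ) : ℝ) / (1 + (((p : ℕ) : ℝ)) * ((((p : ℕ) : ℝ)) - 1))

/-- `C₂(q) := ∑_{p ∤ q} log p/(1 + p(p−1))`; `C₂ = C₂(1)`. [cite: Drappeau2017, §1.1 (definitions of C₂, C₂(q))] -/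
def C2 (q : ℕ) : ℝ :=
  ∑' p : Nat.Primes, logTerm q p

/-- The Fouvry–BFI main term `C₁ x {log x + 2γ − 1 − 2C₂}`. [cite: Drappeau2017, §1.1 Theorem 1 and Theorems 1.1–1.2] -/
def mainTerm (x : ℝ) : ℝ :=
  C1 1 * x * (Real.log x + 2 * Real.eulerMascheroniConstant - 1 - 2 * C2 1)

/-- The secondary (Siegel-zero) term `C₁(q)(x^β/β){log(x/q²) + 2γ − 1/β − 2C₂(q)}` of Theorem 1.2,
which enters with a MINUS sign. [cite: Drappeau2017, §1.1 Theorem 1.2] -/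
def siegelTerm (x : ℝ) (q : ℕ) (β : ℝ) : ℝ :=
  C1 q * (x ^ β / β) *
    (Real.log (x / (q : ℝ) ^ 2) + 2 * Real.eulerMascheroniConstant - 1 / β - 2 * C2 q)

/-- The main term `C₁{x + 2 li(x)(γ − C₂)}` of Corollaries 1.3–1.4. [cite: Drappeau2017, §1.1 Corollary 1.3] -/
def mainTermPrimes (x : ℝ) : ℝ :=
  C1 1 * (x + 2 * logIntegral x * (Real.eulerMascheroniConstant - C2 1))

/-- The secondary term `C₁(q){x^β/β + 2 li(x^β)(γ − log q − C₂(q))}` of Corollary 1.3 (enters with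
a minus sign). [cite: Drappeau2017, §1.1 Corollary 1.3] -/
def siegelTermPrimes (x : ℝ) (q : ℕ) (β : ℝ) : ℝ :=
  C1 q * (x ^ β / β + 2 * logIntegral (x ^ β) *
    (Real.eulerMascheroniConstant - Real.log q - C2 q))

end Drappeau2017

open Drappeau2017 DrappeauFiorilli2021

/-! ### The named facts -/

/-- **Drappeau 2017, Theorem 1.1** (NAMED FACT, AS PRINTED): "Assume GRH. Then for some `δ > 0` and
all `x ≥ 2`, `T(x) = C₁x{log x + 2γ − 1 − 2C₂} + O(x^{1−δ})`." GRH = the Riemann Hypothesis for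
all Dirichlet `L`-functions, the tree's `GeneralizedRiemannHypothesis`; the `O`-constant is one `K`
for all `x ≥ 2`. Not proved here (Kuznetsov formula / sums of Kloosterman sums in progressions,
§§2–6 of the source). [cite: Drappeau2017, §1.1 Theorem 1.1] -/
def drappeau2017_theorem11 : Prop :=
  GeneralizedRiemannHypothesis →
    ∃ δ : ℝ, 0 < δ ∧ ∃ K : ℝ, ∀ x : ℝ, 2 ≤ x → |T x - mainTerm x| ≤ K * x ^ (1 - δ)

/-- **Drappeau 2017, Theorem 1.2** (NAMED FACT, AS PRINTED; Page's `b` and `δ` existential as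
printed, the `O`-constant one `K` for all `x ≥ 2`; "the second term is only to be taken into account
if [the `x`-exceptional character exists]" rendered by the two clauses below, the exceptional triple
being `DrappeauFiorilli2021.IsExceptionalAt b x q χ β` = §6 Lemma 6.1 with `Q = T = e^{√log x}`):
there are `b, δ > 0` with
`T(x) = C₁x{log x + 2γ − 1 − 2C₂} [− C₁(q)(x^β/β){log(x/q²) + 2γ − 1/β − 2C₂(q)}] + O(x e^{−δ√log x})`.
Not proved here. [cite: Drappeau2017, §1.1 Theorem 1.2 with §6 Lemma 6.1 and §6.3] -/
def drappeau2017_theorem12 : Prop :=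
  ∃ b : ℝ, 0 < b ∧ ∃ δ : ℝ, 0 < δ ∧ ∃ K : ℝ, ∀ x : ℝ, 2 ≤ x →
    -- no `x`-exceptional character: the Fouvry–BFI main term alone
    ((¬ ∃ (q : ℕ) (_ : NeZero q) (χ : DirichletCharacter ℂ q) (β : ℝ), IsExceptionalAt b x q χ β) →
      |T x - mainTerm x| ≤ K * (x * Real.exp (-(δ * Real.sqrt (Real.log x))))) ∧
    -- the `x`-exceptional character `χ mod q` with its zero `β` exists: the second term is present
    (∀ (q : ℕ) [NeZero q] (χ : DirichletCharacter ℂ q) (β : ℝ), IsExceptionalAt b x q χ β →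
      |T x - (mainTerm x - siegelTerm x q β)| ≤ K * (x * Real.exp (-(δ * Real.sqrt (Real.log x)))))

/-- **Drappeau 2017, Corollary 1.3** (NAMED FACT, AS PRINTED, "by partial summation" from Theorem
1.2, "in the same notation"): `∑_{p ≤ x} τ(p − 1) = C₁{x + 2 li(x)(γ − C₂)}
[− C₁(q){x^β/β + 2 li(x^β)(γ − log q − C₂(q))}] + O(x e^{−δ√log x})`, the bracket present iff the
`x`-exceptional character exists. Not proved here. [cite: Drappeau2017, §1.1 Corollary 1.3] -/
def drappeau2017_corollary13 : Prop :=
  ∃ b : ℝ, 0 < b ∧ ∃ δ : ℝ, 0 < δ ∧ ∃ K : ℝ, ∀ x : ℝ, 2 ≤ x →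
    ((¬ ∃ (q : ℕ) (_ : NeZero q) (χ : DirichletCharacter ℂ q) (β : ℝ), IsExceptionalAt b x q χ β) →
      |primeDivisorSum x - mainTermPrimes x| ≤
        K * (x * Real.exp (-(δ * Real.sqrt (Real.log x))))) ∧
    (∀ (q : ℕ) [NeZero q] (χ : DirichletCharacter ℂ q) (β : ℝ), IsExceptionalAt b x q χ β →
      |primeDivisorSum x - (mainTermPrimes x - siegelTermPrimes x q β)| ≤
        K * (x * Real.exp (-(δ * Real.sqrt (Real.log x)))))

/-- **Drappeau 2017, Corollary 1.4** (NAMED FACT, AS PRINTED): "With an effective implicit constant,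
we have `∑_{p ≤ x} τ(p − 1) ≤ C₁{x + 2 li(x)(γ − C₂)} + O(x e^{−δ√log x})`." (The exceptional
character, if it exists, is real and `χ(1) = 1`, so its contribution is non-positive and may be
dropped: an UNCONDITIONAL one-sided Titchmarsh divisor estimate with the `e^{−δ√log x}` saving.
Effectivity is recorded in prose only.) Not proved here. [cite: Drappeau2017, §1.1 Corollary 1.4] -/
def drappeau2017_corollary14 : Prop :=
  ∃ δ : ℝ, 0 < δ ∧ ∃ K : ℝ, ∀ x : ℝ, 2 ≤ x →
    primeDivisorSum x ≤ mainTermPrimes x + K * (x * Real.exp (-(δ * Real.sqrt (Real.log x))))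

/-! ### PROVED: the constants `C₁(q) > 0` and `0 ≤ C₂(q) ≤ C₂ < ∞` -/

namespace Drappeau2017

/-- Each Euler factor is `≥ 1`. [cite: Drappeau2017, §1.1 (definitions of C₁, C₁(q))] -/
theorem one_le_eulerFactor (q : ℕ) (p : Nat.Primes) : 1 ≤ eulerFactor q p := by
  unfold eulerFactor
  split_ifs with h
  · exact le_rfl
  · have hp : (2 : ℝ) ≤ ((p : ℕ) : ℝ) := by exact_mod_cast p.prop.two_le
    have : 0 ≤ 1 / (((p : ℕ) : ℝ) * ((((p : ℕ) : ℝ)) - 1)) := by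
      apply div_nonneg zero_le_one; nlinarith
    linarith

/-- The Euler product `∏_{p ∤ q} (1 + 1/(p(p−1)))` is `≥ 1` (as a `tprod`: the limit of partial
products `≥ 1`, or the junk value `1`). [cite: Drappeau2017, §1.1 (definitions of C₁, C₁(q))] -/
theorem one_le_eulerProduct (q : ℕ) : 1 ≤ ∏' p : Nat.Primes, eulerFactor q p := by
  by_cases h : Multipliable (eulerFactor q)
  · refine ge_of_tendsto' h.hasProd fun s => ?_
    exact Finset.prod_induction _ (fun r : ℝ => 1 ≤ r)
      (fun a b ha hb => one_le_mul_of_one_le_of_one_le ha hb) le_rfl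
      (fun p _ => one_le_eulerFactor q p)
  · rw [tprod_eq_one_of_not_multipliable h]

/-- `C₁(q) > 0` for `q ≥ 1`. [cite: Drappeau2017, §1.1 (definitions of C₁, C₁(q))] -/
theorem C1_pos {q : ℕ} (hq : 0 < q) : 0 < C1 q := by
  unfold C1
  have hφ : (0 : ℝ) < (Nat.totient q : ℝ) := by exact_mod_cast Nat.totient_pos.mpr hq
  exact mul_pos (by positivity) (lt_of_lt_of_le one_pos (one_le_eulerProduct q))

/-- Termwise bounds `0 ≤ log p/(1 + p(p−1)) ≤ 4 p^{−3/2}`: `log p ≤ p^{1/2}/(1/2) = 2√p` (Mathlib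
`Real.log_le_rpow_div`) and `1 + p(p−1) ≥ p²/2` for `p ≥ 2`. [folklore] -/
private theorem logTerm_nonneg_le (q : ℕ) (p : Nat.Primes) :
    0 ≤ logTerm q p ∧ logTerm q p ≤ 4 * (((p : ℕ) : ℝ)) ^ (-(3 / 2 : ℝ)) := by
  have hp2 : (2 : ℝ) ≤ ((p : ℕ) : ℝ) := by exact_mod_cast p.prop.two_le
  have hp0 : (0 : ℝ) < ((p : ℕ) : ℝ) := by linarith
  have hden : 0 < 1 + (((p : ℕ) : ℝ)) * ((((p : ℕ) : ℝ)) - 1) := by nlinarith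
  have hrpow_pos : 0 < (((p : ℕ) : ℝ)) ^ (-(3 / 2 : ℝ)) := Real.rpow_pos_of_pos hp0 _
  unfold logTerm
  split_ifs with h
  · exact ⟨le_rfl, by positivity⟩
  refine ⟨div_nonneg (Real.log_nonneg (by linarith)) hden.le, ?_⟩
  -- `log p ≤ 2 √p`
  have hlog : Real.log ((p : ℕ) : ℝ) ≤ (((p : ℕ) : ℝ)) ^ (1 / 2 : ℝ) / (1 / 2) :=
    Real.log_le_rpow_div hp0.le (by norm_num)
  have hsqrt_pos : 0 < (((p : ℕ) : ℝ)) ^ (1 / 2 : ℝ) := Real.rpow_pos_of_pos hp0 _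
  -- `1 + p(p−1) ≥ p²/2`
  have hden2 : (((p : ℕ) : ℝ)) ^ 2 / 2 ≤ 1 + (((p : ℕ) : ℝ)) * ((((p : ℕ) : ℝ)) - 1) := by nlinarith
  -- so the term is `≤ 2√p / (p²/2) = 4 p^{1/2 − 2} = 4 p^{−3/2}`
  have hkey : Real.log ((p : ℕ) : ℝ) / (1 + (((p : ℕ) : ℝ)) * ((((p : ℕ) : ℝ)) - 1)) ≤
      (2 * (((p : ℕ) : ℝ)) ^ (1 / 2 : ℝ)) / ((((p : ℕ) : ℝ)) ^ 2 / 2) := by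
    have h1 : Real.log ((p : ℕ) : ℝ) ≤ 2 * (((p : ℕ) : ℝ)) ^ (1 / 2 : ℝ) := by
      rw [div_eq_mul_inv] at hlog; linarith
    exact div_le_div₀ (by positivity) h1 (by positivity) hden2
  have hpow : (2 * (((p : ℕ) : ℝ)) ^ (1 / 2 : ℝ)) / ((((p : ℕ) : ℝ)) ^ 2 / 2) =
      4 * (((p : ℕ) : ℝ)) ^ (-(3 / 2 : ℝ)) := by
    have h2 : (((p : ℕ) : ℝ)) ^ (2 : ℕ) = (((p : ℕ) : ℝ)) ^ (2 : ℝ) := by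
      rw [← Real.rpow_natCast]; norm_num
    rw [h2]
    have h3 : (((p : ℕ) : ℝ)) ^ (-(3 / 2 : ℝ)) = (((p : ℕ) : ℝ)) ^ (1 / 2 : ℝ) / (((p : ℕ) : ℝ)) ^ (2 : ℝ) := by
      rw [← Real.rpow_sub hp0]; norm_num
    rw [h3]
    field_simp
    ring
  linarith [hpow ▸ hkey]

/-- The series `∑_{p ∤ q} log p/(1 + p(p−1))` converges (domination by `4 ∑_p p^{−3/2}`).
[cite: Drappeau2017, §1.1 (definitions of C₂, C₂(q))] -/
theorem C2_summable (q : ℕ) : Summable (logTerm q) := by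
  have hs : Summable (fun p : Nat.Primes => 4 * (((p : ℕ) : ℝ)) ^ (-(3 / 2 : ℝ))) :=
    (Nat.Primes.summable_rpow.mpr (by norm_num)).mul_left 4
  exact Summable.of_nonneg_of_le (fun p => (logTerm_nonneg_le q p).1)
    (fun p => (logTerm_nonneg_le q p).2) hs

/-- `0 ≤ C₂(q)`. [cite: Drappeau2017, §1.1 (definitions of C₂, C₂(q))] -/
theorem C2_nonneg (q : ℕ) : 0 ≤ C2 q :=
  tsum_nonneg fun p => (logTerm_nonneg_le q p).1

/-- `C₂(q) ≤ C₂ = C₂(1)` (fewer primes in the sum). [cite: Drappeau2017, §1.1 (definitions of C₂, C₂(q))] -/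
theorem C2_le (q : ℕ) : C2 q ≤ C2 1 := by
  refine (C2_summable q).tsum_le_tsum (fun p => ?_) (C2_summable 1)
  unfold logTerm
  have h1 : ¬ ((p : ℕ) ∣ 1) := fun h => p.prop.ne_one (Nat.dvd_one.mp h)
  rw [if_neg h1]
  split_ifs with h
  · have hp2 : (2 : ℝ) ≤ ((p : ℕ) : ℝ) := by exact_mod_cast p.prop.two_le
    exact div_nonneg (Real.log_nonneg (by linarith)) (by nlinarith)
  · exact le_rfl

/-! ### PROVED: the Siegel term is positive (the exceptional contribution is negative) -/

/-- **"Showing it is always negative."** For every `b > 0` there is `x₀ = x₀(b)` such that for all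
`x ≥ x₀` and every `x`-exceptional triple `(q, χ, β)` (level `b`) the Siegel term
`C₁(q)(x^β/β){log(x/q²) + 2γ − 1/β − 2C₂(q)}` is POSITIVE — so the exceptional character LOWERS
`T(x)`: here `C₁(q) > 0`, `x^β/β > 0`, and the bracket is `≥ log x − 2√log x − 2 − 2C₂ > 0` because
`log q ≤ √log x`, `β > 1 − b/(2√log x) ≥ ½` once `√log x ≥ b`, `γ > 0` and `C₂(q) ≤ C₂`.
[cite: Drappeau2017, Abstract ("showing it is always negative") and §1.1 Theorem 1.2] -/
theorem siegelTerm_pos {b : ℝ} (hb : 0 < b) :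
    ∃ x₀ : ℝ, ∀ x : ℝ, x₀ ≤ x → ∀ (q : ℕ) [NeZero q] (χ : DirichletCharacter ℂ q) (β : ℝ),
      IsExceptionalAt b x q χ β → 0 < siegelTerm x q β := by
  -- choose `S₀ = max b (2 + √(2 + 2C₂))` and `x₀ = exp(S₀²)`: then `√log x ≥ S₀`
  set S₀ : ℝ := max (max b 1) (2 + Real.sqrt (2 + 2 * C2 1)) with hS₀
  refine ⟨Real.exp (S₀ ^ 2), fun x hx q _ χ β hE => ?_⟩
  obtain ⟨hqx, -, -, hβ, -⟩ := hE
  have hS₀b : b ≤ S₀ := le_trans (le_max_left _ _) (le_max_left _ _)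
  have hS₀1 : 1 ≤ S₀ := le_trans (le_max_right _ _) (le_max_left _ _)
  have hS₀2 : 2 + Real.sqrt (2 + 2 * C2 1) ≤ S₀ := le_max_right _ _
  have hS₀pos : 0 < S₀ := by linarith
  have hx0 : 0 < x := lt_of_lt_of_le (Real.exp_pos _) hx
  -- `S := √log x ≥ S₀`
  have hlogx : S₀ ^ 2 ≤ Real.log x := by
    rw [← Real.log_exp (S₀ ^ 2)]; exact Real.log_le_log (Real.exp_pos _) hx
  set S : ℝ := Real.sqrt (Real.log x) with hSdef
  have hS : S₀ ≤ S := by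
    rw [hSdef, ← Real.sqrt_sq hS₀pos.le]; exact Real.sqrt_le_sqrt hlogx
  have hSpos : 0 < S := lt_of_lt_of_le hS₀pos hS
  have hlogx0 : 0 ≤ Real.log x := le_trans (sq_nonneg _) hlogx
  have hSS : S ^ 2 = Real.log x := Real.sq_sqrt hlogx0
  -- `β > 1/2` and `β ≤`-free facts
  have hβhalf : 1 / 2 < β := by
    have : b / (2 * S) ≤ 1 / 2 := by
      rw [div_le_iff₀ (by positivity)]; nlinarith
    linarith
  have hβpos : 0 < β := by linarith
  -- `log q ≤ S`
  have hq0 : (0 : ℝ) < q := by exact_mod_cast Nat.pos_of_ne_zero (NeZero.ne q)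
  have hlogq : Real.log q ≤ S := (Real.log_le_iff_le_exp hq0).mpr hqx
  -- the bracket
  have hγ : 0 < Real.eulerMascheroniConstant := by
    have := Real.one_half_lt_eulerMascheroniConstant; linarith
  have hC2 := C2_le q
  have hC2nn := C2_nonneg 1
  have hbr : 0 < Real.log (x / (q : ℝ) ^ 2) + 2 * Real.eulerMascheroniConstant - 1 / β - 2 * C2 q := by
    have hlog_split : Real.log (x / (q : ℝ) ^ 2) = Real.log x - 2 * Real.log q := by
      rw [Real.log_div hx0.ne' (by positivity), Real.log_pow]; push_cast; ring
    have h1β : 1 / β < 2 := by rw [div_lt_iff₀ hβpos]; linarith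
    -- `log x − 2S − 2 − 2C₂ ≥ 0` from `S ≥ 2 + √(2 + 2C₂)`: `(S − 2)·S ≥ … `; use `S² − 2S ≥ 2 + 2C₂`
    have hsq : Real.sqrt (2 + 2 * C2 1) ^ 2 = 2 + 2 * C2 1 := Real.sq_sqrt (by linarith)
    have hSge : 2 + Real.sqrt (2 + 2 * C2 1) ≤ S := le_trans hS₀2 hS
    have hsqrt_nn : 0 ≤ Real.sqrt (2 + 2 * C2 1) := Real.sqrt_nonneg _
    have hmain : 2 + 2 * C2 1 + 2 * S ≤ S ^ 2 := by nlinarith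
    rw [hlog_split, ← hSS]
    linarith
  unfold siegelTerm
  have hC1 := C1_pos (Nat.pos_of_ne_zero (NeZero.ne q))
  have hxβ : 0 < x ^ β / β := div_pos (Real.rpow_pos_of_pos hx0 β) hβpos
  positivity

/-! ### PROVED readings of Theorem 1.2 -/

/-- **No exceptional character ⇒ the Fouvry–BFI main term with an `e^{−δ√log x}` error** (the first
clause of Theorem 1.2, by name). [cite: Drappeau2017, §1.1 Theorem 1.2] -/
theorem T_asymp_of_not_exceptional (h : drappeau2017_theorem12) :
    ∃ b : ℝ, 0 < b ∧ ∃ δ : ℝ, 0 < δ ∧ ∃ K : ℝ, ∀ x : ℝ, 2 ≤ x →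
      (¬ ∃ (q : ℕ) (_ : NeZero q) (χ : DirichletCharacter ℂ q) (β : ℝ), IsExceptionalAt b x q χ β) →
        |T x - mainTerm x| ≤ K * (x * Real.exp (-(δ * Real.sqrt (Real.log x)))) := by
  obtain ⟨b, hb, δ, hδ, K, hK⟩ := h
  exact ⟨b, hb, δ, hδ, K, fun x hx hno => (hK x hx).1 hno⟩

/-- **A Siegel zero switches the secondary term on.** Under Theorem 1.2 (with its `b, δ, K`): a
Tao–Teräväinen Siegel zero of quality `η` attached to `χ` mod `q ≥ 3` with `bη > 2` makes `χ`
`x`-exceptional for `log² q ≤ log x < (bη log q/2)²` (tree: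
`DrappeauFiorilli2021.isExceptionalAt_of_isSiegelZero`), and there
`T(x) = C₁x{…} − C₁(q)(x^β/β){…} + O(x e^{−δ√log x})` with `β = 1 − 1/(η log q)`.
[cite: Drappeau2017, §1.1 Theorem 1.2] [cite: TaoTeravainen2021, Definition 1.4] -/
theorem T_asymp_of_isSiegelZero (h : drappeau2017_theorem12) :
    ∃ b : ℝ, 0 < b ∧ ∃ δ : ℝ, 0 < δ ∧ ∃ K : ℝ,
      ∀ (q : ℕ) [NeZero q], 3 ≤ q → ∀ (χ : DirichletCharacter ℂ q) (η : ℝ), IsSiegelZero χ η →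
        ∀ x : ℝ, 2 ≤ x → Real.log q ^ 2 ≤ Real.log x → Real.log x < (b * η * Real.log q / 2) ^ 2 →
          |T x - (mainTerm x - siegelTerm x q (1 - 1 / (η * Real.log q)))| ≤
            K * (x * Real.exp (-(δ * Real.sqrt (Real.log x)))) := by
  obtain ⟨b, hb, δ, hδ, K, hK⟩ := h
  refine ⟨b, hb, δ, hδ, K, fun q _ hq χ η hS x hx hx1 hx2 => ?_⟩
  exact (hK x hx).2 q χ _ (isExceptionalAt_of_isSiegelZero hb hq hS hx1 hx2)

/-- **`UnboundedSiegelZeros` ⇒ the Titchmarsh divisor sum is lowered at arbitrarily large `x`.**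
Under Theorem 1.2 (with its `b, δ, K`) and the tree's open hypothesis `UnboundedSiegelZeros` (Siegel
zeros of arbitrarily large quality at arbitrarily large conductors): for every `X` there are `x ≥ X`
and an `x`-exceptional triple `(q, χ, β)` whose Siegel term is POSITIVE and for which
`|T(x) − (C₁x{…} − C₁(q)(x^β/β){…})| ≤ K x e^{−δ√log x}` — i.e. `T(x)` sits below the Fouvry–BFI main
term by an explicit positive amount, up to the printed error. (Take a Siegel zero of quality
`η ≥ 4/b` at a conductor `q ≥ max(3, X, x₀(b))` and `x = exp(log² q) ≥ q`: the window
`log² q ≤ log x < (bη log q/2)²` contains `x` since `bη/2 ≥ 2 > 1`.)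
[cite: Drappeau2017, Abstract and §1.1 Theorem 1.2] [cite: TaoTeravainen2021, Definition 1.4] -/
theorem T_lowered_frequently_of_unboundedSiegelZeros (h : drappeau2017_theorem12)
    (hU : Summit.Parity.GeneralizedHardyLittlewood.UnboundedSiegelZeros) :
    ∃ b : ℝ, 0 < b ∧ ∃ δ : ℝ, 0 < δ ∧ ∃ K : ℝ, ∀ X : ℝ, ∃ x : ℝ, X ≤ x ∧
      ∃ (q : ℕ) (_ : NeZero q) (χ : DirichletCharacter ℂ q) (β : ℝ),
        IsExceptionalAt b x q χ β ∧ 0 < siegelTerm x q β ∧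
        |T x - (mainTerm x - siegelTerm x q β)| ≤ K * (x * Real.exp (-(δ * Real.sqrt (Real.log x)))) := by
  obtain ⟨b, hb, δ, hδ, K, hK⟩ := h
  obtain ⟨x₀, hx₀⟩ := siegelTerm_pos hb
  refine ⟨b, hb, δ, hδ, K, fun X => ?_⟩
  -- a Siegel zero of quality `≥ 4/b` at a conductor `q ≥ max(3, ⌈X⌉, ⌈x₀⌉, 2)`
  obtain ⟨q, hq0, χ, η, hq, hη, hS⟩ := hU (4 / b) (max 3 (max ⌈X⌉₊ ⌈x₀⌉₊))
  haveI := hq0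
  have hq3 : 3 ≤ q := le_trans (le_max_left _ _) hq
  have hqX : X ≤ q := le_trans (Nat.le_ceil X)
    (by exact_mod_cast le_trans (le_trans (le_max_left _ _) (le_max_right _ _)) hq)
  have hqx₀ : x₀ ≤ q := le_trans (Nat.le_ceil x₀)
    (by exact_mod_cast le_trans (le_trans (le_max_right _ _) (le_max_right _ _)) hq)
  have hq3r : (3 : ℝ) ≤ q := by exact_mod_cast hq3
  have hq0r : (0 : ℝ) < q := by linarith
  have hlogq : 1 < Real.log (q : ℝ) := by
    have h9 := Real.exp_one_lt_d9
    rw [Real.lt_log_iff_exp_lt hq0r]; linarith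
  -- the point `x = exp(log² q) ≥ q ≥ max(X, x₀, 3)`
  set x : ℝ := Real.exp (Real.log q ^ 2) with hxdef
  have hlogx : Real.log x = Real.log q ^ 2 := Real.log_exp _
  have hqlex : (q : ℝ) ≤ x := by
    calc (q : ℝ) = Real.exp (Real.log q) := (Real.exp_log hq0r).symm
      _ ≤ Real.exp (Real.log q ^ 2) := Real.exp_le_exp.mpr (by nlinarith)
  have hx2 : 2 ≤ x := by linarith
  have hxX : X ≤ x := le_trans hqX hqlex
  have hxx₀ : x₀ ≤ x := le_trans hqx₀ hqlex
  -- the window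
  have hw1 : Real.log q ^ 2 ≤ Real.log x := hlogx.symm.le
  have hw2 : Real.log x < (b * η * Real.log q / 2) ^ 2 := by
    rw [hlogx]
    have hbη : 2 ≤ b * η / 2 := by
      have : 4 / b ≤ η := hη
      rw [div_le_iff₀ hb] at this
      linarith
    have h1 : Real.log q < b * η * Real.log q / 2 := by nlinarith
    have h0 : 0 ≤ Real.log q := by linarith
    exact pow_lt_pow_left₀ h1 h0 two_ne_zero
  have hE := isExceptionalAt_of_isSiegelZero hb hq3 hS hw1 hw2
  exact ⟨x, hxX, q, hq0, χ, _, hE, hx₀ x hxx₀ q χ _ hE, (hK x hx2).2 q χ _ hE⟩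


/-! ### Appended 2026-08-27: the one-sided inequality, `Λ`-weighted (PROVED from Theorem 1.2) -/

/-- `T` is monotone: its summands `Λ(n)τ(n−1)` are nonnegative. [cite: Drappeau2017, §1.1 (definition of T(x))] -/
theorem T_mono {x y : ℝ} (hxy : x ≤ y) : T x ≤ T y := by
  unfold T
  apply Finset.sum_le_sum_of_subset_of_nonneg
  · exact Finset.Ioc_subset_Ioc_right (Nat.floor_le_floor hxy)
  · intro n _ _
    exact mul_nonneg ArithmeticFunction.vonMangoldt_nonneg (Nat.cast_nonneg _)

/-- A crude lower bound for the main term on `x ≥ 1`: `C₁x{log x + 2γ − 1 − 2C₂} ≥ −C₁ x (1 + 2C₂)`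
(`log x ≥ 0`, `γ > 0`). [cite: Drappeau2017, §1.1 Theorem 1] -/
theorem mainTerm_ge {x : ℝ} (hx : 1 ≤ x) : -(C1 1 * x * (1 + 2 * C2 1)) ≤ mainTerm x := by
  unfold mainTerm
  have hC1 := C1_pos one_pos
  have hlog : 0 ≤ Real.log x := Real.log_nonneg hx
  have hγ : 0 < Real.eulerMascheroniConstant := by
    have := Real.one_half_lt_eulerMascheroniConstant; linarith
  have hx0 : 0 ≤ x := by linarith
  have hC1x : 0 ≤ C1 1 * x := mul_nonneg hC1.le hx0
  nlinarith

/-- **The one-sided Titchmarsh inequality, `Λ`-weighted — PROVED from Theorem 1.2** (the analogue for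
`T(x)` of the printed Corollary 1.4, which is the partial-summation version over primes): there are
`δ > 0` and `K` with `T(x) ≤ C₁x{log x + 2γ − 1 − 2C₂} + K x e^{−δ√log x}` for ALL `x ≥ 2`,
unconditionally in the exceptional character — if it exists its contribution `−C₁(q)(x^β/β){…}` is
negative for `x ≥ x₀(b)` (`siegelTerm_pos`), and the finitely-bounded range `2 ≤ x < x₀` is absorbed in
`K` (`T` monotone, the main term `≥ −C₁x(1+2C₂)`, `x e^{−δ√log x} ≥ 2e^{−δ√log x₀}` there).
[cite: Drappeau2017, §1.1 Theorem 1.2 and Corollary 1.4] -/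
theorem T_le_mainTerm_of_theorem12 (h : drappeau2017_theorem12) :
    ∃ δ : ℝ, 0 < δ ∧ ∃ K : ℝ, ∀ x : ℝ, 2 ≤ x →
      T x ≤ mainTerm x + K * (x * Real.exp (-(δ * Real.sqrt (Real.log x)))) := by
  obtain ⟨b, hb, δ, hδ, K, hK⟩ := h
  obtain ⟨x₀, hx₀⟩ := siegelTerm_pos hb
  -- the constant for the initial range `[2, x₀]`
  set x₁ : ℝ := max 2 x₀ with hx₁
  have hx₁2 : 2 ≤ x₁ := le_max_left _ _
  have hx₁0 : x₀ ≤ x₁ := le_max_right _ _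
  set A : ℝ := T x₁ + C1 1 * x₁ * (1 + 2 * C2 1) with hA
  set m : ℝ := 2 * Real.exp (-(δ * Real.sqrt (Real.log x₁))) with hm
  have hm0 : 0 < m := by positivity
  have hA0 : 0 ≤ A := by
    have hT : 0 ≤ T x₁ := by
      have := T_mono (show (1 : ℝ) ≤ x₁ by linarith)
      have h1 : T 1 = 0 := by simp [T]
      linarith
    have := C1_pos one_pos
    have := C2_nonneg 1
    positivity
  refine ⟨δ, hδ, max K (A / m), fun x hx => ?_⟩
  have hx0 : 0 < x := by linarith
  have hE0 : 0 ≤ x * Real.exp (-(δ * Real.sqrt (Real.log x))) := by positivity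
  by_cases hlarge : x₁ ≤ x
  · -- `x ≥ x₀`: Theorem 1.2 with the sign of the Siegel term
    have hKle : K * (x * Real.exp (-(δ * Real.sqrt (Real.log x)))) ≤
        max K (A / m) * (x * Real.exp (-(δ * Real.sqrt (Real.log x)))) :=
      mul_le_mul_of_nonneg_right (le_max_left _ _) hE0
    by_cases hexc : ∃ (q : ℕ) (_ : NeZero q) (χ : DirichletCharacter ℂ q) (β : ℝ),
        IsExceptionalAt b x q χ β
    · obtain ⟨q, hq, χ, β, hEx⟩ := hexc
      have h2 := (hK x hx).2 q χ β hEx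
      have hS := hx₀ x (le_trans hx₁0 hlarge) q χ β hEx
      have := (abs_le.mp h2).2
      linarith
    · have h1 := (hK x hx).1 hexc
      have := (abs_le.mp h1).2
      linarith
  · -- `2 ≤ x < x₁`: everything is bounded
    rw [not_le] at hlarge
    have hT : T x ≤ T x₁ := T_mono hlarge.le
    have hmain := mainTerm_ge (show (1 : ℝ) ≤ x by linarith)
    have hC1 := C1_pos one_pos
    have hC2 := C2_nonneg 1
    have hmain' : -(C1 1 * x₁ * (1 + 2 * C2 1)) ≤ mainTerm x := by
      have : C1 1 * x * (1 + 2 * C2 1) ≤ C1 1 * x₁ * (1 + 2 * C2 1) := by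
        have := mul_le_mul_of_nonneg_left hlarge.le hC1.le
        nlinarith
      linarith
    -- `x e^{−δ√log x} ≥ m = 2 e^{−δ√log x₁}`
    have hlogle : Real.sqrt (Real.log x) ≤ Real.sqrt (Real.log x₁) :=
      Real.sqrt_le_sqrt (Real.log_le_log hx0 hlarge.le)
    have hexp : Real.exp (-(δ * Real.sqrt (Real.log x₁))) ≤ Real.exp (-(δ * Real.sqrt (Real.log x))) :=
      Real.exp_le_exp.mpr (by nlinarith)
    have hmE : m ≤ x * Real.exp (-(δ * Real.sqrt (Real.log x))) := by
      rw [hm]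
      have hpos : 0 < Real.exp (-(δ * Real.sqrt (Real.log x))) := Real.exp_pos _
      nlinarith
    have hAm : A ≤ A / m * (x * Real.exp (-(δ * Real.sqrt (Real.log x)))) := by
      have h1 : A / m * m ≤ A / m * (x * Real.exp (-(δ * Real.sqrt (Real.log x)))) :=
        mul_le_mul_of_nonneg_left hmE (div_nonneg hA0 hm0.le)
      have h2 : A / m * m = A := by field_simp
      linarith
    have hKle : A / m * (x * Real.exp (-(δ * Real.sqrt (Real.log x)))) ≤
        max K (A / m) * (x * Real.exp (-(δ * Real.sqrt (Real.log x)))) :=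
      mul_le_mul_of_nonneg_right (le_max_right _ _) hE0
    linarith


/-! ### Appended 2026-08-27 (ii): Corollary 1.4 DERIVED from Corollary 1.3 (the secondary term over
primes is positive for large `x`, by `li y ∼ y/log y`) -/

/-- `li y ≤ 2y/log y` for all large `y` (from the tree's `li x ∼ x/log x`). [folklore] -/
private theorem exists_logIntegral_le_two_mul : ∃ Y₀ : ℝ, 3 ≤ Y₀ ∧ ∀ y : ℝ, Y₀ ≤ y →
    logIntegral y ≤ 2 * (y / Real.log y) := by
  have h := (isEquivalent_logIntegral_holds).isLittleO
  have h1 := h.def zero_lt_one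
  rw [Filter.eventually_atTop] at h1
  obtain ⟨Y, hY⟩ := h1
  refine ⟨max Y 3, le_max_right _ _, fun y hy => ?_⟩
  have hyY : Y ≤ y := le_trans (le_max_left _ _) hy
  have hy3 : 3 ≤ y := le_trans (le_max_right _ _) hy
  have hlog : 0 < Real.log y := Real.log_pos (by linarith)
  have hf : 0 ≤ y / Real.log y := by positivity
  have := hY y hyY
  simp only [Pi.sub_apply, one_mul, Real.norm_eq_abs] at this
  rw [abs_of_nonneg hf] at this
  have := (abs_le.mp this).2
  linarith

/-- `li y > 0` for `y ≥ 2` (`li 2 > 0` and `li` increasing on `(1, ∞)`). [folklore] -/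
private theorem logIntegral_pos_of_two_le {y : ℝ} (hy : 2 ≤ y) : 0 < logIntegral y := by
  have h2 : 0 < logIntegral 2 := logIntegral_two_pos_holds
  rcases eq_or_lt_of_le hy with h | h
  · rw [← h]; exact h2
  · have hmono := strictMonoOn_logIntegral_holds (show (2 : ℝ) ∈ Set.Ioi 1 by norm_num)
      (show y ∈ Set.Ioi 1 by simp only [Set.mem_Ioi]; linarith) h
    linarith

/-- `li` is monotone on `[2, ∞)`. [folklore] -/
private theorem logIntegral_mono {y z : ℝ} (hy : 2 ≤ y) (hyz : y ≤ z) : logIntegral y ≤ logIntegral z :=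
  strictMonoOn_logIntegral_holds.monotoneOn (show y ∈ Set.Ioi (1 : ℝ) by simp only [Set.mem_Ioi]; linarith)
    (show z ∈ Set.Ioi (1 : ℝ) by simp only [Set.mem_Ioi]; linarith) hyz

/-- **The secondary term over primes is positive for large `x`.** For every level `b` there is `x₀(b)`
such that every `x`-exceptional triple `(q,χ,β)` at `x ≥ x₀` has
`C₁(q){x^β/β + 2 li(x^β)(γ − log q − C₂(q))} > 0`: with `S = √log x`, `log q ≤ S`, `β > ½`,
`0 < li(x^β) ≤ 2x^β/(β S²)` and `γ − log q − C₂(q) ≥ −(S + C₂)`, the bracket is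
`≥ (x^β/β)(1 − 4(S + C₂)/S²) > 0` once `S ≥ 5 + C₂`. [cite: Drappeau2017, §1.1 Corollary 1.3] -/
theorem siegelTermPrimes_pos (b : ℝ) :
    ∃ x₀ : ℝ, ∀ x : ℝ, x₀ ≤ x → ∀ (q : ℕ) [NeZero q] (χ : DirichletCharacter ℂ q) (β : ℝ),
      IsExceptionalAt b x q χ β → 0 < siegelTermPrimes x q β := by
  obtain ⟨Y₀, hY3, hli⟩ := exists_logIntegral_le_two_mul
  set S₀ : ℝ := max (max b 1) (5 + C2 1) with hS₀
  refine ⟨max (Real.exp (S₀ ^ 2)) (Y₀ ^ 2), fun x hx q _ χ β hE => ?_⟩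
  obtain ⟨hqx, -, -, hβ, -⟩ := hE
  have hC2 := C2_le q
  have hC2nn := C2_nonneg 1
  have hS₀b : b ≤ S₀ := le_trans (le_max_left _ _) (le_max_left _ _)
  have hS₀1 : 1 ≤ S₀ := le_trans (le_max_right _ _) (le_max_left _ _)
  have hS₀5 : 5 + C2 1 ≤ S₀ := le_max_right _ _
  have hS₀pos : 0 < S₀ := by linarith
  have hxexp : Real.exp (S₀ ^ 2) ≤ x := le_trans (le_max_left _ _) hx
  have hxY : Y₀ ^ 2 ≤ x := le_trans (le_max_right _ _) hx
  have hx0 : 0 < x := lt_of_lt_of_le (Real.exp_pos _) hxexp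
  have hx1 : 1 ≤ x := by
    have : (1 : ℝ) ≤ Real.exp (S₀ ^ 2) := Real.one_le_exp (sq_nonneg _)
    linarith
  -- `S = √log x ≥ S₀`
  have hlogx : S₀ ^ 2 ≤ Real.log x := by
    rw [← Real.log_exp (S₀ ^ 2)]; exact Real.log_le_log (Real.exp_pos _) hxexp
  set S : ℝ := Real.sqrt (Real.log x) with hSdef
  have hS : S₀ ≤ S := by
    rw [hSdef, ← Real.sqrt_sq hS₀pos.le]; exact Real.sqrt_le_sqrt hlogx
  have hSpos : 0 < S := lt_of_lt_of_le hS₀pos hS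
  have hlogx0 : 0 ≤ Real.log x := le_trans (sq_nonneg _) hlogx
  have hSS : S ^ 2 = Real.log x := Real.sq_sqrt hlogx0
  have hlogxpos : 0 < Real.log x := by rw [← hSS]; positivity
  -- `β > 1/2`
  have hβhalf : 1 / 2 < β := by
    have : b / (2 * S) ≤ 1 / 2 := by
      rw [div_le_iff₀ (by positivity)]; nlinarith
    linarith
  have hβpos : 0 < β := by linarith
  -- `log q ≤ S`
  have hq0 : (0 : ℝ) < q := by exact_mod_cast Nat.pos_of_ne_zero (NeZero.ne q)
  have hlogq : Real.log q ≤ S := (Real.log_le_iff_le_exp hq0).mpr hqx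
  have hlogq0 : 0 ≤ Real.log q := Real.log_natCast_nonneg q
  -- `y = x^β ≥ √x ≥ Y₀ ≥ 3`
  set y : ℝ := x ^ β with hydef
  have hy0 : 0 < y := Real.rpow_pos_of_pos hx0 β
  have hsqrt : Real.sqrt x ≤ y := by
    rw [Real.sqrt_eq_rpow, hydef]
    exact Real.rpow_le_rpow_of_exponent_le hx1 (by linarith)
  have hY0x : Y₀ ≤ Real.sqrt x := by
    rw [← Real.sqrt_sq (by linarith : (0 : ℝ) ≤ Y₀)]; exact Real.sqrt_le_sqrt hxY
  have hyY : Y₀ ≤ y := le_trans hY0x hsqrt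
  have hy2 : 2 ≤ y := by linarith
  have hlogy : Real.log y = β * Real.log x := by rw [hydef, Real.log_rpow hx0]
  -- `0 < li y ≤ 2y/log y = 2y/(β log x)`
  have hli_pos := logIntegral_pos_of_two_le hy2
  have hli_le : logIntegral y ≤ 2 * (y / (β * Real.log x)) := by rw [← hlogy]; exact hli y hyY
  -- the bracket
  have hγ : 0 < Real.eulerMascheroniConstant := by
    have := Real.one_half_lt_eulerMascheroniConstant; linarith
  have hcoef : -(S + C2 1) ≤ Real.eulerMascheroniConstant - Real.log q - C2 q := by linarith
  have hbr : 0 < y / β + 2 * logIntegral y * (Real.eulerMascheroniConstant - Real.log q - C2 q) := by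
    -- `2 li y (γ − log q − C₂(q)) ≥ −2 li y (S + C₂) ≥ −4 y (S + C₂)/(β log x)`
    have hli2 : 0 ≤ 2 * logIntegral y := by linarith
    have h1 : 2 * logIntegral y * (-(S + C2 1)) ≤
        2 * logIntegral y * (Real.eulerMascheroniConstant - Real.log q - C2 q) :=
      mul_le_mul_of_nonneg_left hcoef hli2
    have hSC : 0 ≤ S + C2 1 := by linarith
    have h2 : 2 * logIntegral y * (S + C2 1) ≤ 2 * (2 * (y / (β * Real.log x))) * (S + C2 1) :=
      mul_le_mul_of_nonneg_right (mul_le_mul_of_nonneg_left hli_le (by norm_num)) hSC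
    -- `4 y (S + C₂)/(β log x) < y/β` iff `4(S + C₂) < log x = S²`, true for `S ≥ 5 + C₂`
    have hS5 : 5 + C2 1 ≤ S := le_trans hS₀5 hS
    have hkey : 4 * (S + C2 1) < S ^ 2 := by
      have hSS5 : (5 + C2 1) * S ≤ S * S := mul_le_mul_of_nonneg_right hS5 hSpos.le
      have hC2S : C2 1 * 5 ≤ C2 1 * S := mul_le_mul_of_nonneg_left (by linarith) hC2nn
      nlinarith [hSS5, hC2S, hSpos, hC2nn]
    have h3 : 2 * (2 * (y / (β * Real.log x))) * (S + C2 1) < y / β := by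
      rw [← hSS]
      have hβS : 0 < β * S ^ 2 := by positivity
      have hrew : 2 * (2 * (y / (β * S ^ 2))) * (S + C2 1) = (y * (4 * (S + C2 1))) / (β * S ^ 2) := by
        field_simp
        ring
      rw [hrew, div_lt_div_iff₀ hβS hβpos]
      have h4 : y * (4 * (S + C2 1)) < y * S ^ 2 := mul_lt_mul_of_pos_left hkey hy0
      have h5 : y * (4 * (S + C2 1)) * β < y * S ^ 2 * β := mul_lt_mul_of_pos_right h4 hβpos
      calc y * (4 * (S + C2 1)) * β < y * S ^ 2 * β := h5
        _ = y * (β * S ^ 2) := by ring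
    have h6 : -(2 * (2 * (y / (β * Real.log x))) * (S + C2 1)) ≤
        2 * logIntegral y * (Real.eulerMascheroniConstant - Real.log q - C2 q) := by
      have : 2 * logIntegral y * (-(S + C2 1)) = -(2 * logIntegral y * (S + C2 1)) := by ring
      linarith
    linarith
  unfold siegelTermPrimes
  have hC1 := C1_pos (Nat.pos_of_ne_zero (NeZero.ne q))
  exact mul_pos hC1 hbr

/-- `∑_{p ≤ x} τ(p−1)` is monotone in `x`. [cite: Drappeau2017, §1.1 Corollary 1.3] -/
theorem primeDivisorSum_mono {x y : ℝ} (hxy : x ≤ y) : primeDivisorSum x ≤ primeDivisorSum y := by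
  unfold primeDivisorSum
  apply Finset.sum_le_sum_of_subset_of_nonneg
  · intro p hp
    simp only [Finset.mem_filter, Finset.mem_Iic] at hp ⊢
    exact ⟨le_trans hp.1 (Nat.floor_le_floor hxy), hp.2⟩
  · intro n _ _
    exact Nat.cast_nonneg _

/-- **Corollary 1.4 DERIVED from Corollary 1.3** (so the one-sided Titchmarsh divisor bound carries no
debt beyond Corollary 1.3): the exceptional term `C₁(q){x^β/β + 2li(x^β)(γ − log q − C₂(q))}`, when
present, is POSITIVE for `x ≥ x₀(b)` (`siegelTermPrimes_pos`), hence may be dropped; the bounded range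
`2 ≤ x < x₀` is absorbed in the constant (`∑_{p≤x}τ(p−1)` monotone, `li` monotone and positive on
`[2, ∞)`). [cite: Drappeau2017, §1.1 Corollaries 1.3 and 1.4] -/
theorem corollary14_of_corollary13 (h13 : drappeau2017_corollary13) : drappeau2017_corollary14 := by
  obtain ⟨b, hb, δ, hδ, K, hK⟩ := h13
  obtain ⟨x₀, hx₀⟩ := siegelTermPrimes_pos b
  set x₁ : ℝ := max 2 x₀ with hx₁
  have hx₁2 : 2 ≤ x₁ := le_max_left _ _
  have hx₁0 : x₀ ≤ x₁ := le_max_right _ _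
  have hC1 := C1_pos one_pos
  have hC2 := C2_nonneg 1
  have hγ : 0 < Real.eulerMascheroniConstant := by
    have := Real.one_half_lt_eulerMascheroniConstant; linarith
  have hli₁ : 0 < logIntegral x₁ := logIntegral_pos_of_two_le hx₁2
  -- constant for the initial range
  set A : ℝ := primeDivisorSum x₁ + C1 1 * (2 * logIntegral x₁ * (Real.eulerMascheroniConstant + C2 1))
    with hA
  set m : ℝ := 2 * Real.exp (-(δ * Real.sqrt (Real.log x₁))) with hm
  have hm0 : 0 < m := by positivity
  have hP0 : ∀ z : ℝ, 0 ≤ primeDivisorSum z := fun z => by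
    unfold primeDivisorSum; exact Finset.sum_nonneg fun _ _ => Nat.cast_nonneg _
  have hA0 : 0 ≤ A := by
    have := hP0 x₁
    positivity
  refine ⟨δ, hδ, max K (A / m), fun x hx => ?_⟩
  have hx0 : 0 < x := by linarith
  have hE0 : 0 ≤ x * Real.exp (-(δ * Real.sqrt (Real.log x))) := by positivity
  by_cases hlarge : x₁ ≤ x
  · have hKle : K * (x * Real.exp (-(δ * Real.sqrt (Real.log x)))) ≤
        max K (A / m) * (x * Real.exp (-(δ * Real.sqrt (Real.log x)))) :=
      mul_le_mul_of_nonneg_right (le_max_left _ _) hE0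
    by_cases hexc : ∃ (q : ℕ) (_ : NeZero q) (χ : DirichletCharacter ℂ q) (β : ℝ),
        IsExceptionalAt b x q χ β
    · obtain ⟨q, hq, χ, β, hEx⟩ := hexc
      have h2 := (hK x hx).2 q χ β hEx
      have hS := hx₀ x (le_trans hx₁0 hlarge) q χ β hEx
      have := (abs_le.mp h2).2
      linarith
    · have h1 := (hK x hx).1 hexc
      have := (abs_le.mp h1).2
      linarith
  · rw [not_le] at hlarge
    have hP : primeDivisorSum x ≤ primeDivisorSum x₁ := primeDivisorSum_mono hlarge.le
    -- `mainTermPrimes x ≥ −2 C₁ li(x₁)(γ + C₂)` on `[2, x₁]`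
    have hlix : 0 < logIntegral x := logIntegral_pos_of_two_le hx
    have hlixle : logIntegral x ≤ logIntegral x₁ := logIntegral_mono hx hlarge.le
    have hmain : -(C1 1 * (2 * logIntegral x₁ * (Real.eulerMascheroniConstant + C2 1))) ≤
        mainTermPrimes x := by
      unfold mainTermPrimes
      have h1 : -(2 * logIntegral x₁ * (Real.eulerMascheroniConstant + C2 1)) ≤
          x + 2 * logIntegral x * (Real.eulerMascheroniConstant - C2 1) := by
        nlinarith
      have := mul_le_mul_of_nonneg_left h1 hC1.le
      linarith
    have hlogle : Real.sqrt (Real.log x) ≤ Real.sqrt (Real.log x₁) :=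
      Real.sqrt_le_sqrt (Real.log_le_log hx0 hlarge.le)
    have hexp : Real.exp (-(δ * Real.sqrt (Real.log x₁))) ≤ Real.exp (-(δ * Real.sqrt (Real.log x))) :=
      Real.exp_le_exp.mpr (by nlinarith)
    have hmE : m ≤ x * Real.exp (-(δ * Real.sqrt (Real.log x))) := by
      rw [hm]
      have hpos : 0 < Real.exp (-(δ * Real.sqrt (Real.log x))) := Real.exp_pos _
      nlinarith
    have hAm : A ≤ A / m * (x * Real.exp (-(δ * Real.sqrt (Real.log x)))) := by
      have h1 : A / m * m ≤ A / m * (x * Real.exp (-(δ * Real.sqrt (Real.log x)))) :=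
        mul_le_mul_of_nonneg_left hmE (div_nonneg hA0 hm0.le)
      have h2 : A / m * m = A := by field_simp
      linarith
    have hKle : A / m * (x * Real.exp (-(δ * Real.sqrt (Real.log x)))) ≤
        max K (A / m) * (x * Real.exp (-(δ * Real.sqrt (Real.log x)))) :=
      mul_le_mul_of_nonneg_right (le_max_right _ _) hE0
    linarith

end Drappeau2017

end Literature.NumberTheory.LFunctions

end
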